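import Literature.NumberTheory.NumberFields.CubicField14483Primes
import Literature.NumberTheory.NumberFields.ResidueMapPowers
import HarnessLib

/-!
# The cubic field of discriminant `-14483`, IV: the norm form on `1, γ, δ`, the `2`-adic residue maps
# `𝓞 K → ℤ/2ᵏ`, and the class-group witnesses `(x) = 𝔭 · 𝔭₂ᵏ`

Fourth file on the `2`-division field `K = ℚ(γ)` of `E_{28/9}` (`CubicField14483*.lean`). Towards the class group
(`Cl(K) ≅ ℤ/8` generated by the prime `𝔭₂ = (2, γ)`, numerics of seat bsd-line-spt-p1 g26): for every prime `𝔭` of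
norm `≤ 34` (the Minkowski bound) and for the primes above `2069` one explicit algebraic integer `x` with
`(x) = 𝔭 · 𝔭₂ᵏ`, certified by TWO CONGRUENCES and ONE NORM (`ResidueMapPowers`: `x ∈ 𝔭₂ᵏ ⟺ ψ(x) = 0` for the
residue map `ψ : 𝓞 K → ℤ/2ᵏ` with `ψ(γ) ≡ 0 (mod 2)`; `x ∈ 𝔭` by the residue map of `𝔭`; `|N(x)| = 2ᵏ · N(𝔭)` by the norm
form). Everything is proved; theorems only.

* §0 `norm_lin3` — **`N(a + bγ + cδ) = a³ + a²b + 27ab² - 36b³ + 39abc + 186b²c - 31ac² + 86bc² + 114c³`**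
  (Marcus Ch. 2 Thm. 4 on the power basis, `MonicCubic.norm_lin`, transported to the integral basis `1, γ, δ`).
* §1 `exists_residueHom_two_pow` — the `2`-adic residue maps `ψₖ : 𝓞 K → ℤ/2ᵏ` of the prime `𝔭₂` (`γ ↦ 0, 4, 4, 4, 4, 68, 196`
  mod `4, 8, 16, 32, 64, 128, 256`, `3ψ(δ) = ψ(γ)² - ψ(γ) + 18`), with `ker ψₖ = 𝔭₂ᵏ` (`𝔭₂ = ker ψ₁`, `ψ₁(γ) = 0`).
* §2 the certificate `span_eq_mul_pow_p2_of` and the witnesses (degree-one `𝔭`, written as kernels of residue maps):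
  `(4 - γ) = 𝔭₃ₐ 𝔭₂⁶`, `(-22 + 2γ - 5δ) = 𝔭₃ᵦ 𝔭₂⁷`, `(2 - 4γ - δ) = 𝔭₃꜀ 𝔭₂³` (`𝔭₃ₐ, 𝔭₃ᵦ, 𝔭₃꜀ = ker ψ₃`, `ψ₃(δ) = 0, 1, 2`),
  `(6 - γ - δ) = 𝔭₅ 𝔭₂³` (`𝔭₅ = (5, γ - 3)`), `(-4 - 3γ) = 𝔭₇ 𝔭₂⁴` (`𝔭₇ = (7, γ - 1)`); the sequel
  `CubicField14483Witnesses.lean` has `𝔭₁₉, 𝔭₂₃, 𝔭₂₉, 𝔭₂₀₆₉, 𝔮₂₀₆₉, 𝔮₇` and `𝔭₂⁸ = (6 + γ - δ)`; the degree-two primes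
  `𝔮₂`, `𝔮₅` come after that.

## References
* [Marcus2018] D. A. Marcus, *Number Fields*, 2nd ed. (2018), Ch. 2 Thm. 4 (norm), Ch. 3 Thm. 22, Thm. 27, Ch. 5 Thm. 35
  (class group by primes below the Minkowski bound).
-/

noncomputable section

open Polynomial Module NumberField Ideal
open scoped NumberField

namespace Literature.NumberTheory.NumberFields

namespace CubicField14483

open MonicCubic

variable {K : Type*} [Field K] [NumberField K] {γ : K}

/-! ### §0 The norm form on the integral basis `1, γ, δ` -/

/-- **`N(a + bγ + cδ) = a³ + a²b + 27ab² - 36b³ + 39abc + 186b²c - 31ac² + 86bc² + 114c³`.**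
[cite: Marcus2018, Ch. 2, Thm. 4] -/
theorem norm_lin3 (hγ : γ ^ 3 - γ ^ 2 + 27 * γ + 36 = 0) (h3 : finrank ℚ K = 3) (a b c : ℤ) :
    Algebra.norm ℤ (((a : 𝓞 K) + b * thetaInt (aeval_eq hγ) + c * thetaInt (delta_root hγ) : 𝓞 K)) =
      a ^ 3 + a ^ 2 * b + 27 * a * b ^ 2 - 36 * b ^ 3 + 39 * a * b * c + 186 * b ^ 2 * c - 31 * a * c ^ 2
        + 86 * b * c ^ 2 + 114 * c ^ 3 := by
  have h := Algebra.coe_norm_int (((a : 𝓞 K) + b * thetaInt (aeval_eq hγ) + c * thetaInt (delta_root hγ) : 𝓞 K))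
  rw [coe_lin hγ a b c] at h
  have hn := MonicCubic.norm_lin irreducible_polyQ (aeval_eq hγ) h3 (a + 6 * c : ℚ) (b - c / 3 : ℚ) (c / 3 : ℚ)
  rw [hn, MonicCubic.normForm] at h
  have h' : ((Algebra.norm ℤ (((a : 𝓞 K) + b * thetaInt (aeval_eq hγ) + c * thetaInt (delta_root hγ) : 𝓞 K)) : ℤ) : ℚ)
      = ((a ^ 3 + a ^ 2 * b + 27 * a * b ^ 2 - 36 * b ^ 3 + 39 * a * b * c + 186 * b ^ 2 * c - 31 * a * c ^ 2
        + 86 * b * c ^ 2 + 114 * c ^ 3 : ℤ) : ℚ) := by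
    rw [h]; push_cast; ring
  exact_mod_cast h'

/-! ### §1 The `2`-adic residue maps of `𝔭₂ = (2, γ)` -/

/-- **Residue maps `ψ : 𝓞 K → ℤ/2ᵏ` with prescribed `ψ(γ) = r`**, `r` a root of `f` modulo `2ᵏ` (`3` is invertible
mod `2ᵏ`), and `3ψ(δ) = r² - r + 18`. [cite: Marcus2018, Ch. 3, Thm. 27] -/
theorem exists_residueHom_two_pow (hγ : γ ^ 3 - γ ^ 2 + 27 * γ + 36 = 0) (h3 : finrank ℚ K = 3) (k : ℕ)
    (r : ℤ) (hr : (r : ZMod (2 ^ k)) ^ 3 + ((-1 : ℤ) : ZMod (2 ^ k)) * (r : ZMod (2 ^ k)) ^ 2 +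
      ((27 : ℤ) : ZMod (2 ^ k)) * r + ((36 : ℤ) : ZMod (2 ^ k)) = 0)
    (s : ZMod (2 ^ k)) (hs : ((3 : ℕ) : ZMod (2 ^ k)) * s = 1) :
    ∃ ψ : 𝓞 K →+* ZMod (2 ^ k), ψ (thetaInt (aeval_eq hγ)) = r ∧
      3 * ψ (thetaInt (delta_root hγ)) = (r : ZMod (2 ^ k)) ^ 2 - r + 18 := by
  obtain ⟨ψ, hψ⟩ := exists_ringHom_of_root_of_mul_mem irreducible_polyQ (aeval_eq hγ) h3 (mem3 hγ h3)
    (r : ZMod (2 ^ k)) (by exact_mod_cast hr) s hs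
  refine ⟨ψ, hψ, ?_⟩
  have h := congrArg ψ (three_delta hγ)
  rw [map_mul, map_ofNat, map_add, map_sub, map_pow, map_ofNat, hψ] at h
  exact h

/-- **`ker ψ = 𝔭₂ᵏ`** for such a `ψ` with `ψ(γ)` even, where `𝔭₂ = ker ψ₁` for any `ψ₁ : 𝓞 K → ℤ/2` with `ψ₁(γ) = 0`
(`ResidueMapPowers.ker_zmodPow_eq_pow` and uniqueness of the residue map at `γ ↦ 0`).
[cite: Marcus2018, Ch. 3, Thm. 27] -/
theorem ker_eq_pow_p2 (hγ : γ ^ 3 - γ ^ 2 + 27 * γ + 36 = 0) (h3 : finrank ℚ K = 3) {k : ℕ} (hk : 1 ≤ k)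
    (ψ : 𝓞 K →+* ZMod (2 ^ k)) (hψ : ZMod.castHom (dvd_pow_self 2 (by omega)) (ZMod 2) (ψ (thetaInt (aeval_eq hγ))) = 0)
    (ψ₁ : 𝓞 K →+* ZMod 2) (h₁ : ψ₁ (thetaInt (aeval_eq hγ)) = 0) :
    RingHom.ker ψ = RingHom.ker ψ₁ ^ k := by
  haveI : Fact (Nat.Prime 2) := ⟨Nat.prime_two⟩
  refine ker_zmodPow_eq_pow_of_comp_eq ψ hk ψ₁ ?_
  refine MonicCubic.residueHom_unique (aeval_eq hγ) (mem3 hγ h3) (by norm_num) _ _ ?_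
  rw [RingHom.comp_apply, hψ, h₁]

/-! ### §2 The witnesses `(x) = 𝔭 · 𝔭₂ᵏ` -/

/-- The common certificate: `x ∈ ker ψ` (`ψ : 𝓞 K → ℤ/2ᵏ` of the `𝔭₂`-branch), `x ∈ ker φ` (`φ : 𝓞 K → ℤ/q`, `q` an odd
prime), `|N(x)| = 2ᵏ q` give `(x) = (ker φ) · 𝔭₂ᵏ`. [cite: Marcus2018, Ch. 3, Thm. 22] -/
theorem span_eq_mul_pow_p2_of (hγ : γ ^ 3 - γ ^ 2 + 27 * γ + 36 = 0) (h3 : finrank ℚ K = 3) {k : ℕ} (hk : 1 ≤ k)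
    (ψ : 𝓞 K →+* ZMod (2 ^ k)) (hψ : ZMod.castHom (dvd_pow_self 2 (by omega)) (ZMod 2) (ψ (thetaInt (aeval_eq hγ))) = 0)
    (ψ₁ : 𝓞 K →+* ZMod 2) (h₁ : ψ₁ (thetaInt (aeval_eq hγ)) = 0)
    {q : ℕ} [hq : Fact q.Prime] (hq2 : q ≠ 2) (φ : 𝓞 K →+* ZMod q)
    {x : 𝓞 K} (hxψ : ψ x = 0) (hxφ : φ x = 0) (hN : (Algebra.norm ℤ x).natAbs = q * 2 ^ k) :
    span {x} = RingHom.ker φ * RingHom.ker ψ₁ ^ k := by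
  haveI : Fact (Nat.Prime 2) := ⟨Nat.prime_two⟩
  have hker := ker_eq_pow_p2 hγ h3 hk ψ hψ ψ₁ h₁
  have hx2 : x ∈ RingHom.ker ψ₁ ^ k := by rw [← hker, RingHom.mem_ker]; exact hxψ
  have hne : RingHom.ker φ ≠ RingHom.ker ψ₁ := ker_ne_ker_of_ne φ ψ₁ hq2
  refine span_singleton_eq_mul_of_mem_of_mem ((RingHom.mem_ker).mpr hxφ) hx2
    (by simpa using isCoprime_pow_of_isMaximal_ne (ker_zmod_isMaximal φ) (ker_zmod_isMaximal ψ₁) hne 1 k) ?_ ?_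
  · rw [hN, map_pow, absNorm_ker_zmod, absNorm_ker_zmod]
  · intro h0
    rw [h0, Algebra.norm_zero, Int.natAbs_zero] at hN
    have hpos : 0 < q * 2 ^ k := Nat.mul_pos hq.out.pos (pow_pos two_pos k)
    omega

/-- **`(4 + -1γ + 0δ) = 𝔭 · 𝔭₂^6`** with `𝔭 = ker φ`, `φ : 𝓞 K → ℤ/3`, `(φ(γ), φ(δ)) = (1, 0)`; certificate:
`ψ(x) = 0` for the `2`-adic residue map `𝓞 K → ℤ/64`, `γ ↦ 4`, `δ ↦ 10`; `φ(x) = 0`; `|N(x)| = 3 · 2^6`.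
[cite: Marcus2018, Ch. 5, Thm. 35] -/
theorem span_witness_p3a (hγ : γ ^ 3 - γ ^ 2 + 27 * γ + 36 = 0) (h3 : finrank ℚ K = 3)
    (ψ₁ : 𝓞 K →+* ZMod 2) (h₁ : ψ₁ (thetaInt (aeval_eq hγ)) = 0)
    (φ : 𝓞 K →+* ZMod 3) (hφγ : φ (thetaInt (aeval_eq hγ)) = 1) (hφδ : φ (thetaInt (delta_root hγ)) = 0) :
    span {((4 : ℤ) : 𝓞 K) + (-1 : ℤ) * thetaInt (aeval_eq hγ) + (0 : ℤ) * thetaInt (delta_root hγ)} =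
      RingHom.ker φ * RingHom.ker ψ₁ ^ 6 := by
  -- finite facts, decided before any local instance is in scope
  have hr : ((4 : ℤ) : ZMod (2 ^ 6)) ^ 3 + ((-1 : ℤ) : ZMod (2 ^ 6)) * ((4 : ℤ) : ZMod (2 ^ 6)) ^ 2 +
      ((27 : ℤ) : ZMod (2 ^ 6)) * (4 : ℤ) + ((36 : ℤ) : ZMod (2 ^ 6)) = 0 := by decide
  have hs : ((3 : ℕ) : ZMod (2 ^ 6)) * 43 = 1 := by decide
  have hd' : (43 : ZMod (2 ^ 6)) * (((4 : ℤ) : ZMod (2 ^ 6)) ^ 2 - ((4 : ℤ) : ZMod (2 ^ 6)) + 18) = 10 := by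
    decide
  have hs3 : (43 : ZMod (2 ^ 6)) * 3 = 1 := by decide
  have hc : ((4 : ℤ) : ZMod (2 ^ 6)) = 4 := by decide
  have hx2 : ((4 : ℤ) : ZMod (2 ^ 6)) + ((-1 : ℤ) : ZMod (2 ^ 6)) * 4 + ((0 : ℤ) : ZMod (2 ^ 6)) * 10 = 0 := by
    decide
  have hxq : ((4 : ℤ) : ZMod 3) + ((-1 : ℤ) : ZMod 3) * 1 + ((0 : ℤ) : ZMod 3) * 0 = 0 := by decide
  have hcast : ZMod.castHom (dvd_pow_self 2 (by omega : (6 : ℕ) ≠ 0)) (ZMod 2) ((4 : ℤ) : ZMod (2 ^ 6)) = 0 := by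
    rw [map_intCast]; decide
  haveI : Fact (Nat.Prime 3) := ⟨Nat.prime_three⟩
  obtain ⟨ψ, hψγ, hψδ3⟩ := exists_residueHom_two_pow hγ h3 6 4 hr 43 hs
  have hψδ : ψ (thetaInt (delta_root hγ)) = 10 := by
    have h := congrArg (fun t => (43 : ZMod (2 ^ 6)) * t) hψδ3
    rw [← mul_assoc, hs3, one_mul, hd'] at h
    exact h
  refine span_eq_mul_pow_p2_of hγ h3 (k := 6) (by norm_num) ψ (by rw [hψγ]; exact hcast) ψ₁ h₁ (q := 3)
    (by norm_num) φ ?_ ?_ ?_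
  · simp only [map_add, map_mul, map_intCast, hψγ, hψδ, hc]; exact hx2
  · simp only [map_add, map_mul, map_intCast, hφγ, hφδ]; exact hxq
  · rw [norm_lin3 hγ h3]; norm_num


/-- **`(-22 + 2γ + -5δ) = 𝔭 · 𝔭₂^7`** with `𝔭 = ker φ`, `φ : 𝓞 K → ℤ/3`, `(φ(γ), φ(δ)) = (0, 1)`; certificate:
`ψ(x) = 0` for the `2`-adic residue map `𝓞 K → ℤ/128`, `γ ↦ 68`, `δ ↦ 74`; `φ(x) = 0`; `|N(x)| = 3 · 2^7`.
[cite: Marcus2018, Ch. 5, Thm. 35] -/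
theorem span_witness_p3b (hγ : γ ^ 3 - γ ^ 2 + 27 * γ + 36 = 0) (h3 : finrank ℚ K = 3)
    (ψ₁ : 𝓞 K →+* ZMod 2) (h₁ : ψ₁ (thetaInt (aeval_eq hγ)) = 0)
    (φ : 𝓞 K →+* ZMod 3) (hφγ : φ (thetaInt (aeval_eq hγ)) = 0) (hφδ : φ (thetaInt (delta_root hγ)) = 1) :
    span {((-22 : ℤ) : 𝓞 K) + (2 : ℤ) * thetaInt (aeval_eq hγ) + (-5 : ℤ) * thetaInt (delta_root hγ)} =
      RingHom.ker φ * RingHom.ker ψ₁ ^ 7 := by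
  -- finite facts, decided before any local instance is in scope
  have hr : ((68 : ℤ) : ZMod (2 ^ 7)) ^ 3 + ((-1 : ℤ) : ZMod (2 ^ 7)) * ((68 : ℤ) : ZMod (2 ^ 7)) ^ 2 +
      ((27 : ℤ) : ZMod (2 ^ 7)) * (68 : ℤ) + ((36 : ℤ) : ZMod (2 ^ 7)) = 0 := by decide
  have hs : ((3 : ℕ) : ZMod (2 ^ 7)) * 43 = 1 := by decide
  have hd' : (43 : ZMod (2 ^ 7)) * (((68 : ℤ) : ZMod (2 ^ 7)) ^ 2 - ((68 : ℤ) : ZMod (2 ^ 7)) + 18) = 74 := by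
    decide
  have hs3 : (43 : ZMod (2 ^ 7)) * 3 = 1 := by decide
  have hc : ((68 : ℤ) : ZMod (2 ^ 7)) = 68 := by decide
  have hx2 : ((-22 : ℤ) : ZMod (2 ^ 7)) + ((2 : ℤ) : ZMod (2 ^ 7)) * 68 + ((-5 : ℤ) : ZMod (2 ^ 7)) * 74 = 0 := by
    decide
  have hxq : ((-22 : ℤ) : ZMod 3) + ((2 : ℤ) : ZMod 3) * 0 + ((-5 : ℤ) : ZMod 3) * 1 = 0 := by decide
  have hcast : ZMod.castHom (dvd_pow_self 2 (by omega : (7 : ℕ) ≠ 0)) (ZMod 2) ((68 : ℤ) : ZMod (2 ^ 7)) = 0 := by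
    rw [map_intCast]; decide
  haveI : Fact (Nat.Prime 3) := ⟨Nat.prime_three⟩
  obtain ⟨ψ, hψγ, hψδ3⟩ := exists_residueHom_two_pow hγ h3 7 68 hr 43 hs
  have hψδ : ψ (thetaInt (delta_root hγ)) = 74 := by
    have h := congrArg (fun t => (43 : ZMod (2 ^ 7)) * t) hψδ3
    rw [← mul_assoc, hs3, one_mul, hd'] at h
    exact h
  refine span_eq_mul_pow_p2_of hγ h3 (k := 7) (by norm_num) ψ (by rw [hψγ]; exact hcast) ψ₁ h₁ (q := 3)
    (by norm_num) φ ?_ ?_ ?_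
  · simp only [map_add, map_mul, map_intCast, hψγ, hψδ, hc]; exact hx2
  · simp only [map_add, map_mul, map_intCast, hφγ, hφδ]; exact hxq
  · rw [norm_lin3 hγ h3]; norm_num

/-- **`(2 + -4γ + -1δ) = 𝔭 · 𝔭₂^3`** with `𝔭 = ker φ`, `φ : 𝓞 K → ℤ/3`, `(φ(γ), φ(δ)) = (0, 2)`; certificate:
`ψ(x) = 0` for the `2`-adic residue map `𝓞 K → ℤ/8`, `γ ↦ 4`, `δ ↦ 2`; `φ(x) = 0`; `|N(x)| = 3 · 2^3`.
[cite: Marcus2018, Ch. 5, Thm. 35] -/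
theorem span_witness_p3c (hγ : γ ^ 3 - γ ^ 2 + 27 * γ + 36 = 0) (h3 : finrank ℚ K = 3)
    (ψ₁ : 𝓞 K →+* ZMod 2) (h₁ : ψ₁ (thetaInt (aeval_eq hγ)) = 0)
    (φ : 𝓞 K →+* ZMod 3) (hφγ : φ (thetaInt (aeval_eq hγ)) = 0) (hφδ : φ (thetaInt (delta_root hγ)) = 2) :
    span {((2 : ℤ) : 𝓞 K) + (-4 : ℤ) * thetaInt (aeval_eq hγ) + (-1 : ℤ) * thetaInt (delta_root hγ)} =
      RingHom.ker φ * RingHom.ker ψ₁ ^ 3 := by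
  -- finite facts, decided before any local instance is in scope
  have hr : ((4 : ℤ) : ZMod (2 ^ 3)) ^ 3 + ((-1 : ℤ) : ZMod (2 ^ 3)) * ((4 : ℤ) : ZMod (2 ^ 3)) ^ 2 +
      ((27 : ℤ) : ZMod (2 ^ 3)) * (4 : ℤ) + ((36 : ℤ) : ZMod (2 ^ 3)) = 0 := by decide
  have hs : ((3 : ℕ) : ZMod (2 ^ 3)) * 3 = 1 := by decide
  have hd' : (3 : ZMod (2 ^ 3)) * (((4 : ℤ) : ZMod (2 ^ 3)) ^ 2 - ((4 : ℤ) : ZMod (2 ^ 3)) + 18) = 2 := by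
    decide
  have hs3 : (3 : ZMod (2 ^ 3)) * 3 = 1 := by decide
  have hc : ((4 : ℤ) : ZMod (2 ^ 3)) = 4 := by decide
  have hx2 : ((2 : ℤ) : ZMod (2 ^ 3)) + ((-4 : ℤ) : ZMod (2 ^ 3)) * 4 + ((-1 : ℤ) : ZMod (2 ^ 3)) * 2 = 0 := by
    decide
  have hxq : ((2 : ℤ) : ZMod 3) + ((-4 : ℤ) : ZMod 3) * 0 + ((-1 : ℤ) : ZMod 3) * 2 = 0 := by decide
  have hcast : ZMod.castHom (dvd_pow_self 2 (by omega : (3 : ℕ) ≠ 0)) (ZMod 2) ((4 : ℤ) : ZMod (2 ^ 3)) = 0 := by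
    rw [map_intCast]; decide
  haveI : Fact (Nat.Prime 3) := ⟨Nat.prime_three⟩
  obtain ⟨ψ, hψγ, hψδ3⟩ := exists_residueHom_two_pow hγ h3 3 4 hr 3 hs
  have hψδ : ψ (thetaInt (delta_root hγ)) = 2 := by
    have h := congrArg (fun t => (3 : ZMod (2 ^ 3)) * t) hψδ3
    rw [← mul_assoc, hs3, one_mul, hd'] at h
    exact h
  refine span_eq_mul_pow_p2_of hγ h3 (k := 3) (by norm_num) ψ (by rw [hψγ]; exact hcast) ψ₁ h₁ (q := 3)
    (by norm_num) φ ?_ ?_ ?_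
  · simp only [map_add, map_mul, map_intCast, hψγ, hψδ, hc]; exact hx2
  · simp only [map_add, map_mul, map_intCast, hφγ, hφδ]; exact hxq
  · rw [norm_lin3 hγ h3]; norm_num

/-- **`(6 + -1γ + -1δ) = 𝔭 · 𝔭₂^3`** with `𝔭 = ker φ`, `φ : 𝓞 K → ℤ/5`, `(φ(γ), φ(δ)) = (3, 3)`; certificate:
`ψ(x) = 0` for the `2`-adic residue map `𝓞 K → ℤ/8`, `γ ↦ 4`, `δ ↦ 2`; `φ(x) = 0`; `|N(x)| = 5 · 2^3`.
[cite: Marcus2018, Ch. 5, Thm. 35] -/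
theorem span_witness_p5 (hγ : γ ^ 3 - γ ^ 2 + 27 * γ + 36 = 0) (h3 : finrank ℚ K = 3)
    (ψ₁ : 𝓞 K →+* ZMod 2) (h₁ : ψ₁ (thetaInt (aeval_eq hγ)) = 0)
    (φ : 𝓞 K →+* ZMod 5) (hφγ : φ (thetaInt (aeval_eq hγ)) = 3) (hφδ : φ (thetaInt (delta_root hγ)) = 3) :
    span {((6 : ℤ) : 𝓞 K) + (-1 : ℤ) * thetaInt (aeval_eq hγ) + (-1 : ℤ) * thetaInt (delta_root hγ)} =
      RingHom.ker φ * RingHom.ker ψ₁ ^ 3 := by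
  -- finite facts, decided before any local instance is in scope
  have hr : ((4 : ℤ) : ZMod (2 ^ 3)) ^ 3 + ((-1 : ℤ) : ZMod (2 ^ 3)) * ((4 : ℤ) : ZMod (2 ^ 3)) ^ 2 +
      ((27 : ℤ) : ZMod (2 ^ 3)) * (4 : ℤ) + ((36 : ℤ) : ZMod (2 ^ 3)) = 0 := by decide
  have hs : ((3 : ℕ) : ZMod (2 ^ 3)) * 3 = 1 := by decide
  have hd' : (3 : ZMod (2 ^ 3)) * (((4 : ℤ) : ZMod (2 ^ 3)) ^ 2 - ((4 : ℤ) : ZMod (2 ^ 3)) + 18) = 2 := by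
    decide
  have hs3 : (3 : ZMod (2 ^ 3)) * 3 = 1 := by decide
  have hc : ((4 : ℤ) : ZMod (2 ^ 3)) = 4 := by decide
  have hx2 : ((6 : ℤ) : ZMod (2 ^ 3)) + ((-1 : ℤ) : ZMod (2 ^ 3)) * 4 + ((-1 : ℤ) : ZMod (2 ^ 3)) * 2 = 0 := by
    decide
  have hxq : ((6 : ℤ) : ZMod 5) + ((-1 : ℤ) : ZMod 5) * 3 + ((-1 : ℤ) : ZMod 5) * 3 = 0 := by decide
  have hcast : ZMod.castHom (dvd_pow_self 2 (by omega : (3 : ℕ) ≠ 0)) (ZMod 2) ((4 : ℤ) : ZMod (2 ^ 3)) = 0 := by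
    rw [map_intCast]; decide
  haveI : Fact (Nat.Prime 5) := ⟨by norm_num⟩
  obtain ⟨ψ, hψγ, hψδ3⟩ := exists_residueHom_two_pow hγ h3 3 4 hr 3 hs
  have hψδ : ψ (thetaInt (delta_root hγ)) = 2 := by
    have h := congrArg (fun t => (3 : ZMod (2 ^ 3)) * t) hψδ3
    rw [← mul_assoc, hs3, one_mul, hd'] at h
    exact h
  refine span_eq_mul_pow_p2_of hγ h3 (k := 3) (by norm_num) ψ (by rw [hψγ]; exact hcast) ψ₁ h₁ (q := 5)
    (by norm_num) φ ?_ ?_ ?_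
  · simp only [map_add, map_mul, map_intCast, hψγ, hψδ, hc]; exact hx2
  · simp only [map_add, map_mul, map_intCast, hφγ, hφδ]; exact hxq
  · rw [norm_lin3 hγ h3]; norm_num

/-- **`(-4 + -3γ + 0δ) = 𝔭 · 𝔭₂^4`** with `𝔭 = ker φ`, `φ : 𝓞 K → ℤ/7`, `(φ(γ), φ(δ)) = (1, 6)`; certificate:
`ψ(x) = 0` for the `2`-adic residue map `𝓞 K → ℤ/16`, `γ ↦ 4`, `δ ↦ 10`; `φ(x) = 0`; `|N(x)| = 7 · 2^4`.
[cite: Marcus2018, Ch. 5, Thm. 35] -/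
theorem span_witness_p7 (hγ : γ ^ 3 - γ ^ 2 + 27 * γ + 36 = 0) (h3 : finrank ℚ K = 3)
    (ψ₁ : 𝓞 K →+* ZMod 2) (h₁ : ψ₁ (thetaInt (aeval_eq hγ)) = 0)
    (φ : 𝓞 K →+* ZMod 7) (hφγ : φ (thetaInt (aeval_eq hγ)) = 1) (hφδ : φ (thetaInt (delta_root hγ)) = 6) :
    span {((-4 : ℤ) : 𝓞 K) + (-3 : ℤ) * thetaInt (aeval_eq hγ) + (0 : ℤ) * thetaInt (delta_root hγ)} =
      RingHom.ker φ * RingHom.ker ψ₁ ^ 4 := by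
  -- finite facts, decided before any local instance is in scope
  have hr : ((4 : ℤ) : ZMod (2 ^ 4)) ^ 3 + ((-1 : ℤ) : ZMod (2 ^ 4)) * ((4 : ℤ) : ZMod (2 ^ 4)) ^ 2 +
      ((27 : ℤ) : ZMod (2 ^ 4)) * (4 : ℤ) + ((36 : ℤ) : ZMod (2 ^ 4)) = 0 := by decide
  have hs : ((3 : ℕ) : ZMod (2 ^ 4)) * 11 = 1 := by decide
  have hd' : (11 : ZMod (2 ^ 4)) * (((4 : ℤ) : ZMod (2 ^ 4)) ^ 2 - ((4 : ℤ) : ZMod (2 ^ 4)) + 18) = 10 := by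
    decide
  have hs3 : (11 : ZMod (2 ^ 4)) * 3 = 1 := by decide
  have hc : ((4 : ℤ) : ZMod (2 ^ 4)) = 4 := by decide
  have hx2 : ((-4 : ℤ) : ZMod (2 ^ 4)) + ((-3 : ℤ) : ZMod (2 ^ 4)) * 4 + ((0 : ℤ) : ZMod (2 ^ 4)) * 10 = 0 := by
    decide
  have hxq : ((-4 : ℤ) : ZMod 7) + ((-3 : ℤ) : ZMod 7) * 1 + ((0 : ℤ) : ZMod 7) * 6 = 0 := by decide
  have hcast : ZMod.castHom (dvd_pow_self 2 (by omega : (4 : ℕ) ≠ 0)) (ZMod 2) ((4 : ℤ) : ZMod (2 ^ 4)) = 0 := by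
    rw [map_intCast]; decide
  haveI : Fact (Nat.Prime 7) := ⟨by norm_num⟩
  obtain ⟨ψ, hψγ, hψδ3⟩ := exists_residueHom_two_pow hγ h3 4 4 hr 11 hs
  have hψδ : ψ (thetaInt (delta_root hγ)) = 10 := by
    have h := congrArg (fun t => (11 : ZMod (2 ^ 4)) * t) hψδ3
    rw [← mul_assoc, hs3, one_mul, hd'] at h
    exact h
  refine span_eq_mul_pow_p2_of hγ h3 (k := 4) (by norm_num) ψ (by rw [hψγ]; exact hcast) ψ₁ h₁ (q := 7)
    (by norm_num) φ ?_ ?_ ?_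
  · simp only [map_add, map_mul, map_intCast, hψγ, hψδ, hc]; exact hx2
  · simp only [map_add, map_mul, map_intCast, hφγ, hφδ]; exact hxq
  · rw [norm_lin3 hγ h3]; norm_num

end CubicField14483

end Literature.NumberTheory.NumberFields

end
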